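import Mathlib
import Summits.Ventures.PercRepro2.A3CutScale

/-!
# The graph with a mark-free part turned into loops at its cut vertex
(blind cell PercRepro2, night-1 g32; proofs/NIGHT1-G32.md §4 (E3); the theorems are A3CutInvisible.lean)

Let `x` be a cut vertex with the marks in `VB ∪ {x}`.  `loopA ends EA x` is the graph with every `A`-edge
turned into a loop at `x` («`G − P`»).  Its open subgraph at `ω` is the open subgraph of `G` at the
`B`-restriction of `ω` (`openGraph_loopA`), so its connectivity events are the `B`-side events of `G`
(`fibre_loopA`, `avoidAll_loopA`, `PDEvent_loopA`, `connEvent_loopA`), its fibre masses at `x` are the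
`B`-side masses of A3CutScale (`mW_loopA`, `prob_fibre_conn_loopA`), the global masses agree
(`probQ_loopA`, `probQconn_loopA`, `probPD_loopA`, `probPDconn_loopA`), and every generic fibre sum of `x`
on `G − P` is the `B`-side fibre sum (`sum_fibre_x_loopA`).  Standard axioms.
-/

namespace Summit.Ventures.PercRepro2

open UnionCluster CovForm CutV

namespace CovForm

namespace A3Fibre

section LoopA

variable {V : Type*} {E : Type*} [Fintype V] [DecidableEq V] [Fintype E] [DecidableEq E]
  {ends : E → Sym2 V} {x : V} {VA VB : Finset V} {EA EB : Set E} [DecidablePred (· ∈ EA)]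
  [DecidablePred (· ∈ EB)]

/-- The graph with every `A`-edge turned into a loop at `x`. -/
def loopA (ends : E → Sym2 V) (EA : Set E) [DecidablePred (· ∈ EA)] (x : V) : E → Sym2 V :=
  fun e => if e ∈ EA then s(x, x) else ends e

omit [Fintype V] [DecidableEq V] [Fintype E] [DecidableEq E] in
/-- The open subgraph of `G − P` at `ω` is the open subgraph of `G` at the `B`-restriction of `ω`. -/
lemma openGraph_loopA (h : IsCut ends x ↑VA ↑VB EA EB) (ω : Config E) :
    openGraph (loopA ends EA x) ω = openGraph ends (restrict EB ω) := by
  ext u w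
  rw [openGraph_adj, openGraph_adj]
  constructor
  · rintro ⟨huw, e, he, hends⟩
    refine ⟨huw, e, ?_, ?_⟩
    · have heA : e ∉ EA := by
        intro heA
        simp only [loopA, heA, if_true, Sym2.eq_iff] at hends
        rcases hends with ⟨h1, h2⟩ | ⟨h1, h2⟩
        · exact huw (h1.symm.trans h2)
        · exact huw (h2.symm.trans h1)
      have heB : e ∈ EB := (h.cover e).resolve_left heA
      rw [restrict_apply_of_mem heB]
      exact he
    · have heA : e ∉ EA := by
        intro heA
        simp only [loopA, heA, if_true, Sym2.eq_iff] at hends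
        rcases hends with ⟨h1, h2⟩ | ⟨h1, h2⟩
        · exact huw (h1.symm.trans h2)
        · exact huw (h2.symm.trans h1)
      simpa [loopA, heA] using hends
  · rintro ⟨huw, e, he, hends⟩
    have heB : e ∈ EB := by
      by_contra heB
      rw [restrict_apply_of_notMem heB] at he
      exact Bool.false_ne_true he
    have heA : e ∉ EA := Set.disjoint_right.1 h.Edisj heB
    refine ⟨huw, e, ?_, ?_⟩
    · rwa [restrict_apply_of_mem heB] at he
    · simp [loopA, heA, hends]

omit [Fintype V] [DecidableEq V] [Fintype E] [DecidableEq E] in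
/-- Connections in `G − P` are connections of `G` at the `B`-restriction. -/
lemma conn_loopA_iff (h : IsCut ends x ↑VA ↑VB EA EB) (ω : Config E) (u w : V) :
    Conn (loopA ends EA x) ω u w ↔ Conn ends (restrict EB ω) u w := by
  unfold Conn
  rw [openGraph_loopA h ω]

omit [Fintype V] [DecidableEq V] [Fintype E] [DecidableEq E] in
/-- Clusters in `G − P` are clusters of `G` at the `B`-restriction. -/
lemma cluster_loopA (h : IsCut ends x ↑VA ↑VB EA EB) (ω : Config E) (u : V) :
    cluster (loopA ends EA x) ω u = cluster ends (restrict EB ω) u := by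
  ext w
  simp only [mem_cluster]
  exact conn_loopA_iff h ω u w

omit [Fintype V] [DecidableEq V] [Fintype E] [DecidableEq E] in
/-- The fibre–connection events of `G − P` are `B`-side events of `G`. -/
lemma fibre_loopA_inter_conn (h : IsCut ends x ↑VA ↑VB EA EB) (a₁ a₂ r y : V) (W : Finset V) :
    fibre (loopA ends EA x) a₁ a₂ x W ∩ connEvent (loopA ends EA x) r y =
      sideEvent EB (fibre ends a₁ a₂ x W ∩ connEvent ends r y) := by
  ext ω
  simp only [fibre, Set.mem_inter_iff, mem_avoidAll, Finset.mem_singleton, forall_eq, mem_clusterEvent,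
    mem_connEvent, mem_sideEvent, conn_loopA_iff h, cluster_loopA h]

omit [Fintype V] [DecidableEq V] [Fintype E] [DecidableEq E] in
/-- The fibres of `G − P` are `B`-side events of `G`. -/
lemma fibre_loopA (h : IsCut ends x ↑VA ↑VB EA EB) (a₁ a₂ : V) (W : Finset V) :
    fibre (loopA ends EA x) a₁ a₂ x W = sideEvent EB (fibre ends a₁ a₂ x W) := by
  ext ω
  simp only [fibre, Set.mem_inter_iff, mem_avoidAll, Finset.mem_singleton, forall_eq, mem_clusterEvent,
    mem_sideEvent, conn_loopA_iff h, cluster_loopA h]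

omit [Fintype V] [DecidableEq V] [Fintype E] [DecidableEq E] in
/-- `Q` of `G − P` is the `B`-side `Q`. -/
lemma avoidAll_loopA (h : IsCut ends x ↑VA ↑VB EA EB) (a₁ a₂ : V) :
    avoidAll (loopA ends EA x) a₂ {a₁} = sideEvent EB (avoidAll ends a₂ {a₁}) := by
  ext ω
  simp only [mem_avoidAll, Finset.mem_singleton, forall_eq, mem_sideEvent, conn_loopA_iff h]

omit [Fintype V] [DecidableEq V] [Fintype E] [DecidableEq E] in
/-- `PD` of `G − P` is the `B`-side `PD`. -/
lemma PDEvent_loopA (h : IsCut ends x ↑VA ↑VB EA EB) (a₁ a₂ : V) :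
    PDEvent (loopA ends EA x) a₁ a₂ x = sideEvent EB (PDEvent ends a₁ a₂ x) := by
  ext ω
  simp only [PDEvent, Dtilde, UnionCluster.inU, Set.mem_inter_iff, Set.mem_compl_iff, Set.mem_union,
    mem_connEvent, mem_sideEvent, conn_loopA_iff h]

omit [Fintype V] [DecidableEq V] [Fintype E] [DecidableEq E] in
/-- Connection events of `G − P` are `B`-side events. -/
lemma connEvent_loopA (h : IsCut ends x ↑VA ↑VB EA EB) (r y : V) :
    connEvent (loopA ends EA x) r y = sideEvent EB (connEvent ends r y) := by
  ext ω
  simp only [mem_connEvent, mem_sideEvent, conn_loopA_iff h]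

omit [Fintype V] [DecidableEq V] [Fintype E] [DecidableEq E] in
/-- A `B`-side event of a `B`-side event is itself (`restrict` is idempotent). -/
lemma sideEvent_sideEvent (F : Set E) [DecidablePred (· ∈ F)] (A : Set (Config E)) :
    sideEvent F (sideEvent F A) = sideEvent F A := by
  ext ω
  simp only [mem_sideEvent]
  have : restrict F (restrict F ω) = restrict F ω := by
    funext e
    by_cases he : e ∈ F
    · rw [restrict_apply_of_mem he]
    · rw [restrict_apply_of_notMem he, restrict_apply_of_notMem he]
  rw [this]

variable {R : Type*} [CommRing R] {p : E → R}

omit [Fintype V] [DecidableEq V] in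
/-- The fibre mass of `x` on `G − P`. -/
lemma mW_loopA (h : IsCut ends x ↑VA ↑VB EA EB) (a₁ a₂ : V) (W : Finset V) :
    mW p (loopA ends EA x) a₁ a₂ x W =
      prob p (sideEvent EB (clusterEvent ends x (↑W : Set V) ∩ avoidAll ends a₂ {a₁})) := by
  unfold mW
  rw [fibre_loopA h]
  unfold fibre
  rw [Set.inter_comm]

omit [Fintype V] [DecidableEq V] in
/-- The fibre–connection mass of `x` on `G − P`. -/
lemma prob_fibre_conn_loopA (h : IsCut ends x ↑VA ↑VB EA EB) (a₁ a₂ r y : V) (W : Finset V) :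
    prob p (fibre (loopA ends EA x) a₁ a₂ x W ∩ connEvent (loopA ends EA x) r y) =
      prob p (sideEvent EB (clusterEvent ends x (↑W : Set V) ∩
        (avoidAll ends a₂ {a₁} ∩ connEvent ends r y))) := by
  rw [fibre_loopA_inter_conn h]
  unfold fibre
  rw [Set.inter_comm (avoidAll ends a₂ {a₁}), Set.inter_assoc]

omit [Fintype V] in
/-- `P(Q)` on `G − P` is `P(Q)` (the roots in `VB ∪ {x}`). -/
lemma probQ_loopA (h : IsCut ends x ↑VA ↑VB EA EB) {a₁ a₂ : V} (h1 : a₁ ∈ insert x VB)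
    (h2 : a₂ ∈ insert x VB) :
    prob p (avoidAll (loopA ends EA x) a₂ {a₁}) = prob p (avoidAll ends a₂ {a₁}) := by
  rw [avoidAll_loopA h, ← avoidAll_eq_sideEventB' h h1 h2]

omit [Fintype V] in
/-- `P(Q ∩ {r ↔ y})` on `G − P`. -/
lemma probQconn_loopA (h : IsCut ends x ↑VA ↑VB EA EB) {a₁ a₂ : V} (h1 : a₁ ∈ insert x VB)
    (h2 : a₂ ∈ insert x VB) {r y : V} (hr : r ∈ insert x VB) (hy : y ∈ insert x VB) :
    prob p (avoidAll (loopA ends EA x) a₂ {a₁} ∩ connEvent (loopA ends EA x) r y) =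
      prob p (avoidAll ends a₂ {a₁} ∩ connEvent ends r y) := by
  rw [avoidAll_loopA h, connEvent_loopA h, ← avoidAll_eq_sideEventB' h h1 h2,
    ← connEvent_eq_sideEventB' h hr hy]

omit [Fintype V] in
/-- `P(PD_x)` on `G − P` is `P(PD_x)`. -/
lemma probPD_loopA (h : IsCut ends x ↑VA ↑VB EA EB) {a₁ a₂ : V} (h1 : a₁ ∈ insert x VB)
    (h2 : a₂ ∈ insert x VB) :
    prob p (PDEvent (loopA ends EA x) a₁ a₂ x) = prob p (PDEvent ends a₁ a₂ x) := by
  rw [PDEvent_loopA h]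
  have : sideEvent EB (PDEvent ends a₁ a₂ x) = PDEvent ends a₁ a₂ x := by
    ext ω
    simp only [mem_sideEvent, PDEvent, Dtilde, UnionCluster.inU, Set.mem_inter_iff, Set.mem_compl_iff,
      Set.mem_union, mem_connEvent]
    rw [← conn_iff_restrict h.symm (mem_coe_union_of_mem_insert h1) (mem_coe_union_of_mem_insert h2),
      ← conn_iff_restrict h.symm (Or.inr rfl) (mem_coe_union_of_mem_insert h1),
      ← conn_iff_restrict h.symm (Or.inr rfl) (mem_coe_union_of_mem_insert h2)]
  rw [this]

omit [Fintype V] in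
/-- `P(PD_x ∩ {r ↔ y})` on `G − P`. -/
lemma probPDconn_loopA (h : IsCut ends x ↑VA ↑VB EA EB) {a₁ a₂ : V} (h1 : a₁ ∈ insert x VB)
    (h2 : a₂ ∈ insert x VB) {r y : V} (hr : r ∈ insert x VB) (hy : y ∈ insert x VB) :
    prob p (PDEvent (loopA ends EA x) a₁ a₂ x ∩ connEvent (loopA ends EA x) r y) =
      prob p (PDEvent ends a₁ a₂ x ∩ connEvent ends r y) := by
  rw [PDEvent_loopA h, connEvent_loopA h, ← connEvent_eq_sideEventB' h hr hy]
  have : sideEvent EB (PDEvent ends a₁ a₂ x) = PDEvent ends a₁ a₂ x := by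
    ext ω
    simp only [mem_sideEvent, PDEvent, Dtilde, UnionCluster.inU, Set.mem_inter_iff, Set.mem_compl_iff,
      Set.mem_union, mem_connEvent]
    rw [← conn_iff_restrict h.symm (mem_coe_union_of_mem_insert h1) (mem_coe_union_of_mem_insert h2),
      ← conn_iff_restrict h.symm (Or.inr rfl) (mem_coe_union_of_mem_insert h1),
      ← conn_iff_restrict h.symm (Or.inr rfl) (mem_coe_union_of_mem_insert h2)]
  rw [this]

/-- **The generic fibre sum of `x` on `G − P` is the `B`-side fibre sum.** -/
lemma sum_fibre_x_loopA (h : IsCut ends x ↑VA ↑VB EA EB) {o a₁ a₂ b : V}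
    (T : Finset V → R → R → R → R → R → R) (hT0 : ∀ W, T W 0 0 0 0 0 = 0) :
    ∑ W, T W (mW p (loopA ends EA x) a₁ a₂ x W) (Ssig p (loopA ends EA x) a₁ a₂ x b W)
        (Ssig p (loopA ends EA x) a₁ a₂ x o W) (Su p (loopA ends EA x) a₁ a₂ x b W)
        (Su p (loopA ends EA x) a₁ a₂ x o W) =
      ∑ W ∈ (insert x VB).powerset, T W
          (prob p (sideEvent EB (clusterEvent ends x (↑W : Set V) ∩ avoidAll ends a₂ {a₁})))
          (prob p (sideEvent EB (clusterEvent ends x (↑W : Set V) ∩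
              (avoidAll ends a₂ {a₁} ∩ connEvent ends a₁ b))) -
            prob p (sideEvent EB (clusterEvent ends x (↑W : Set V) ∩
              (avoidAll ends a₂ {a₁} ∩ connEvent ends a₂ b))))
          (prob p (sideEvent EB (clusterEvent ends x (↑W : Set V) ∩
              (avoidAll ends a₂ {a₁} ∩ connEvent ends a₁ o))) -
            prob p (sideEvent EB (clusterEvent ends x (↑W : Set V) ∩
              (avoidAll ends a₂ {a₁} ∩ connEvent ends a₂ o))))
          (prob p (sideEvent EB (clusterEvent ends x (↑W : Set V) ∩
              (avoidAll ends a₂ {a₁} ∩ connEvent ends a₁ b))) +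
            prob p (sideEvent EB (clusterEvent ends x (↑W : Set V) ∩
              (avoidAll ends a₂ {a₁} ∩ connEvent ends a₂ b))))
          (prob p (sideEvent EB (clusterEvent ends x (↑W : Set V) ∩
              (avoidAll ends a₂ {a₁} ∩ connEvent ends a₁ o))) +
            prob p (sideEvent EB (clusterEvent ends x (↑W : Set V) ∩
              (avoidAll ends a₂ {a₁} ∩ connEvent ends a₂ o)))) := by
  symm
  apply Finset.sum_subset (Finset.subset_univ _) ?_ |>.trans ?_
  · intro W _ hW
    rw [Finset.mem_powerset] at hW
    -- the `B`-side cluster of `x` lies in `VB ∪ {x}`: the `B`-side fibre at `W` is empty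
    have hz : ∀ Y : Set (Config E),
        prob p (sideEvent EB (clusterEvent ends x (↑W : Set V) ∩ Y)) = 0 := by
      intro Y
      have : sideEvent EB (clusterEvent ends x (↑W : Set V) ∩ Y) = ∅ := by
        ext ω
        simp only [mem_sideEvent, Set.mem_inter_iff, mem_clusterEvent, Set.mem_empty_iff_false,
          iff_false, not_and]
        intro hc _
        apply hW
        intro u hu
        have hu' : u ∈ cluster ends (restrict EB ω) x := by rw [hc]; exact Finset.mem_coe.2 hu
        rcases cluster_restrict_subset h.symm (Or.inr rfl) hu' with huB | hux
        · exact Finset.mem_insert_of_mem (Finset.mem_coe.1 huB)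
        · rw [Set.mem_singleton_iff] at hux
          exact hux ▸ Finset.mem_insert_self x VB
      rw [this, prob_empty]
    simp only [hz, sub_self, add_zero, hT0]
  · refine Finset.sum_congr rfl fun W _ => ?_
    unfold Ssig Su
    rw [mW_loopA h, prob_fibre_conn_loopA h, prob_fibre_conn_loopA h, prob_fibre_conn_loopA h,
      prob_fibre_conn_loopA h]

end LoopA

end A3Fibre

end CovForm

end Summit.Ventures.PercRepro2
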